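import Mathlib.Analysis.SpecialFunctions.Pow.Real
import Mathlib.Algebra.Order.Chebyshev
import HarnessLib

/-!
# The shears of `ℤ²` expand (Lee, Lemma 2.2) and the resulting `ℓ²` bound (Gabber–Galil, first step)

The "initial expanding object" behind the Margulis–Gabber–Galil expanders (J. R. Lee, *On expanders
from the action of GL(2,ℤ)*, 2013, §2, after Linial–London): the graph on `ℤ² ∖ {0}` in which `z`
is joined to `S z, S⁻¹ z, T z, T⁻¹ z` for the shears `S(x,y) = (x, x+y)`, `T(x,y) = (x+y, y)`.

* `card_le_card_leaving` — **Lee, Lemma 2.2**: every finite `U ⊆ ℤ² ∖ {0}` has at least `|U|` darts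
  `(z, M)`, `z ∈ U`, `M ∈ {S, T, S⁻¹, T⁻¹}`, with `M z ∉ U` (on the quadrant `x > 0, y ≥ 0` the images
  `S(U₁)` and `T(U₁)` lie in the quadrant, on opposite sides of the diagonal, so at least `|U₁|` of
  these `2|U₁|` points are outside `U`; the other quadrants likewise);
* `sum_le_var₁` — the `ℓ¹` co-area consequence: for `F ≥ 0` finitely supported off `0`,
  `∑_z |F(S z) - F(z)| + |F(T z) - F(z)| ≥ ∑_z F(z)` (peeling off the minimum positive level);
* **`sum_sq_le_eight_mul_energy`** — for `h ≥ 0` finitely supported off `0`,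
  `∑_z h(z)² ≤ 8 ∑_z (h(S z) - h(z))² + (h(T z) - h(z))²` (Cauchy–Schwarz on `F = h²`), the
  discrete Cheeger step (Lee, Lemma 2.1 with `Δ = 4`).

Sums over `ℤ²` are written over a finite window `V` outside of which the function and its shifted
copies vanish.

## References

* J. R. Lee, *On expanders from the action of GL(2,ℤ)*, arXiv:1301.6296 (2013), Lemma 2.1, Lemma 2.2.
* O. Gabber, Z. Galil, *Explicit constructions of linear-sized superconcentrators*, JCSS 22 (1981).
* S. Hoory, N. Linial, A. Wigderson, *Expander graphs and their applications*, Bull. AMS 43 (2006), §8.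
-/

namespace Literature.Computability.Complexity

open Finset

namespace GabberGalil

/-! ### The four shears -/

/-- `S(x, y) = (x, x + y)`. [cite: Lee2013GL2Z, §2] -/
def shS (z : ℤ × ℤ) : ℤ × ℤ := (z.1, z.1 + z.2)

/-- `T(x, y) = (x + y, y)`. [cite: Lee2013GL2Z, §2] -/
def shT (z : ℤ × ℤ) : ℤ × ℤ := (z.1 + z.2, z.2)

/-- `S⁻¹(x, y) = (x, y - x)`. [cite: Lee2013GL2Z, §2] -/
def shSi (z : ℤ × ℤ) : ℤ × ℤ := (z.1, z.2 - z.1)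

/-- `T⁻¹(x, y) = (x - y, y)`. [cite: Lee2013GL2Z, §2] -/
def shTi (z : ℤ × ℤ) : ℤ × ℤ := (z.1 - z.2, z.2)

/-- The four maps, indexed: `0 ↦ S`, `1 ↦ T`, `2 ↦ S⁻¹`, `3 ↦ T⁻¹`. [folklore] -/
def sh (i : Fin 4) (z : ℤ × ℤ) : ℤ × ℤ :=
  if i = 0 then shS z else if i = 1 then shT z else if i = 2 then shSi z else shTi z

/-- `S⁻¹ ∘ S = id`. [folklore] -/
@[simp] theorem shSi_shS (z : ℤ × ℤ) : shSi (shS z) = z := by unfold shSi shS; ext <;> simp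
/-- `S ∘ S⁻¹ = id`. [folklore] -/
@[simp] theorem shS_shSi (z : ℤ × ℤ) : shS (shSi z) = z := by unfold shSi shS; ext <;> simp
/-- `T⁻¹ ∘ T = id`. [folklore] -/
@[simp] theorem shTi_shT (z : ℤ × ℤ) : shTi (shT z) = z := by unfold shTi shT; ext <;> simp
/-- `T ∘ T⁻¹ = id`. [folklore] -/
@[simp] theorem shT_shTi (z : ℤ × ℤ) : shT (shTi z) = z := by unfold shTi shT; ext <;> simp

/-- `S` is injective. [folklore] -/
theorem shS_injective : Function.Injective shS := fun a b h => by simpa using congrArg shSi h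
/-- `T` is injective. [folklore] -/
theorem shT_injective : Function.Injective shT := fun a b h => by simpa using congrArg shTi h
/-- `S⁻¹` is injective. [folklore] -/
theorem shSi_injective : Function.Injective shSi := fun a b h => by simpa using congrArg shS h
/-- `T⁻¹` is injective. [folklore] -/
theorem shTi_injective : Function.Injective shTi := fun a b h => by simpa using congrArg shT h

/-! ### Lee's Lemma 2.2 -/

/-- The darts `(z, M)` leaving `U`. [cite: Lee2013GL2Z, Lemma 2.2] -/
def leaving (U : Finset (ℤ × ℤ)) : Finset ((ℤ × ℤ) × Fin 4) := (U ×ˢ univ).filter fun p => sh p.2 p.1 ∉ U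

/-- One quadrant: two injective maps `M₁, M₂` preserving a region `Q` with disjoint images there give at
least `|U ∩ Q|` leaving darts from `U ∩ Q`. [cite: Lee2013GL2Z, Lemma 2.2 (proof)] -/
theorem card_filter_le_card_leaving_quadrant (U : Finset (ℤ × ℤ)) (Q : ℤ × ℤ → Prop) [DecidablePred Q]
    (i₁ i₂ : Fin 4)
    (hinj₁ : Function.Injective (sh i₁)) (hinj₂ : Function.Injective (sh i₂))
    (hQ₁ : ∀ z, Q z → Q (sh i₁ z)) (hQ₂ : ∀ z, Q z → Q (sh i₂ z))
    (hdisj : ∀ z z', Q z → Q z' → sh i₁ z ≠ sh i₂ z') :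
    (U.filter Q).card ≤ ((leaving U).filter fun p => Q p.1 ∧ (p.2 = i₁ ∨ p.2 = i₂)).card := by
  classical
  set UQ := U.filter Q with hUQ
  set X := UQ.image (sh i₁) ∪ UQ.image (sh i₂) with hX
  -- `|X| = 2 |UQ|`
  have hXcard : X.card = UQ.card + UQ.card := by
    rw [hX, card_union_of_disjoint, card_image_of_injective _ hinj₁, card_image_of_injective _ hinj₂]
    rw [disjoint_left]
    intro w hw₁ hw₂
    rw [mem_image] at hw₁ hw₂
    obtain ⟨z, hz, rfl⟩ := hw₁
    obtain ⟨z', hz', h⟩ := hw₂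
    exact hdisj z z' (mem_filter.1 hz).2 (mem_filter.1 hz').2 h.symm
  -- `X ∩ U ⊆ UQ`
  have hXU : (X ∩ U).card ≤ UQ.card := by
    refine card_le_card fun w hw => ?_
    rw [mem_inter] at hw
    rw [hUQ, mem_filter]
    refine ⟨hw.2, ?_⟩
    rw [hX, mem_union, mem_image, mem_image] at hw
    rcases hw.1 with ⟨z, hz, rfl⟩ | ⟨z, hz, rfl⟩
    · exact hQ₁ z (mem_filter.1 hz).2
    · exact hQ₂ z (mem_filter.1 hz).2
  -- so `|X \\ U| ≥ |UQ|`
  have hsd : UQ.card ≤ (X \ U).card := by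
    have := card_sdiff_add_card_inter X U
    omega
  -- `X \\ U` is contained in the image of the leaving darts under `(z, i) ↦ sh i z`
  refine hsd.trans ?_
  have himg : X \ U ⊆ ((leaving U).filter fun p => Q p.1 ∧ (p.2 = i₁ ∨ p.2 = i₂)).image fun p => sh p.2 p.1 := by
    intro w hw
    rw [mem_sdiff] at hw
    rw [mem_image]
    rw [hX, mem_union, mem_image, mem_image] at hw
    rcases hw.1 with ⟨z, hz, rfl⟩ | ⟨z, hz, rfl⟩
    · refine ⟨(z, i₁), ?_, rfl⟩
      rw [mem_filter, leaving, mem_filter, mem_product]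
      exact ⟨⟨⟨(mem_filter.1 hz).1, mem_univ _⟩, hw.2⟩, (mem_filter.1 hz).2, Or.inl rfl⟩
    · refine ⟨(z, i₂), ?_, rfl⟩
      rw [mem_filter, leaving, mem_filter, mem_product]
      exact ⟨⟨⟨(mem_filter.1 hz).1, mem_univ _⟩, hw.2⟩, (mem_filter.1 hz).2, Or.inr rfl⟩
  exact (card_le_card himg).trans card_image_le

/-- **Lee, Lemma 2.2**: a finite set of nonzero lattice points has at least as many leaving shear darts as
points. [cite: Lee2013GL2Z, Lemma 2.2] -/
theorem card_le_card_leaving (U : Finset (ℤ × ℤ)) (h0 : ((0, 0) : ℤ × ℤ) ∉ U) : U.card ≤ (leaving U).card := by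
  classical
  -- the four quadrants
  let Q₁ : ℤ × ℤ → Prop := fun z => 0 < z.1 ∧ 0 ≤ z.2
  let Q₂ : ℤ × ℤ → Prop := fun z => z.1 ≤ 0 ∧ 0 < z.2
  let Q₃ : ℤ × ℤ → Prop := fun z => z.1 < 0 ∧ z.2 ≤ 0
  let Q₄ : ℤ × ℤ → Prop := fun z => 0 ≤ z.1 ∧ z.2 < 0
  have hsh0 : ∀ z, sh 0 z = shS z := fun z => rfl
  have hsh1 : ∀ z, sh 1 z = shT z := fun z => rfl
  have hsh2 : ∀ z, sh 2 z = shSi z := fun z => rfl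
  have hsh3 : ∀ z, sh 3 z = shTi z := fun z => rfl
  -- quadrant 1 and 3: maps `S` (index 0) and `T` (index 1)
  have h1 := card_filter_le_card_leaving_quadrant U Q₁ 0 1
    (fun a b h => shS_injective (by rwa [hsh0, hsh0] at h)) (fun a b h => shT_injective (by rwa [hsh1, hsh1] at h))
    (fun z hz => by simp only [hsh0, shS, Q₁] at hz ⊢; constructor <;> linarith [hz.1, hz.2])
    (fun z hz => by simp only [hsh1, shT, Q₁] at hz ⊢; constructor <;> linarith [hz.1, hz.2])
    (fun z z' hz hz' h => by
      simp only [hsh0, hsh1, shS, shT, Q₁, Prod.mk.injEq] at hz hz' h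
      -- `S z` is on or above the diagonal, `T z'` strictly below
      have : z.1 + z.2 ≥ z.1 := by linarith [hz.2]
      have : z'.1 + z'.2 > z'.2 := by linarith [hz'.1]
      omega)
  have h3 := card_filter_le_card_leaving_quadrant U Q₃ 0 1
    (fun a b h => shS_injective (by rwa [hsh0, hsh0] at h)) (fun a b h => shT_injective (by rwa [hsh1, hsh1] at h))
    (fun z hz => by simp only [hsh0, shS, Q₃] at hz ⊢; constructor <;> linarith [hz.1, hz.2])
    (fun z hz => by simp only [hsh1, shT, Q₃] at hz ⊢; constructor <;> linarith [hz.1, hz.2])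
    (fun z z' hz hz' h => by
      simp only [hsh0, hsh1, shS, shT, Q₃, Prod.mk.injEq] at hz hz' h
      omega)
  -- quadrant 2 and 4: maps `S⁻¹` (index 2) and `T⁻¹` (index 3)
  have h2 := card_filter_le_card_leaving_quadrant U Q₂ 2 3
    (fun a b h => shSi_injective (by rwa [hsh2, hsh2] at h)) (fun a b h => shTi_injective (by rwa [hsh3, hsh3] at h))
    (fun z hz => by simp only [hsh2, shSi, Q₂] at hz ⊢; constructor <;> linarith [hz.1, hz.2])
    (fun z hz => by simp only [hsh3, shTi, Q₂] at hz ⊢; constructor <;> linarith [hz.1, hz.2])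
    (fun z z' hz hz' h => by
      simp only [hsh2, hsh3, shSi, shTi, Q₂, Prod.mk.injEq] at hz hz' h
      omega)
  have h4 := card_filter_le_card_leaving_quadrant U Q₄ 2 3
    (fun a b h => shSi_injective (by rwa [hsh2, hsh2] at h)) (fun a b h => shTi_injective (by rwa [hsh3, hsh3] at h))
    (fun z hz => by simp only [hsh2, shSi, Q₄] at hz ⊢; constructor <;> linarith [hz.1, hz.2])
    (fun z hz => by simp only [hsh3, shTi, Q₄] at hz ⊢; constructor <;> linarith [hz.1, hz.2])
    (fun z z' hz hz' h => by
      simp only [hsh2, hsh3, shSi, shTi, Q₄, Prod.mk.injEq] at hz hz' h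
      omega)
  -- `U` is covered by its four quadrants (`0 ∉ U`)
  have hcover : U ⊆ (U.filter Q₁ ∪ U.filter Q₂) ∪ (U.filter Q₃ ∪ U.filter Q₄) := by
    intro z hz
    have hz0 : z ≠ (0, 0) := fun h => h0 (h ▸ hz)
    simp only [mem_union, mem_filter, Q₁, Q₂, Q₃, Q₄]
    by_cases h1 : 0 < z.1
    · by_cases h2 : 0 ≤ z.2
      · exact Or.inl (Or.inl ⟨hz, h1, h2⟩)
      · exact Or.inr (Or.inr ⟨hz, h1.le, lt_of_not_ge h2⟩)
    · by_cases h2 : 0 < z.2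
      · exact Or.inl (Or.inr ⟨hz, not_lt.1 h1, h2⟩)
      · rcases lt_or_eq_of_le (not_lt.1 h1) with h1' | h1'
        · exact Or.inr (Or.inl ⟨hz, h1', not_lt.1 h2⟩)
        · have : z.2 < 0 := lt_of_le_of_ne (not_lt.1 h2) fun h => hz0 (Prod.ext h1' h)
          exact Or.inr (Or.inr ⟨hz, h1'.ge, this⟩)
  have hUle : U.card ≤ (U.filter Q₁).card + (U.filter Q₂).card + ((U.filter Q₃).card + (U.filter Q₄).card) :=
    (card_le_card hcover).trans ((card_union_le _ _).trans (add_le_add (card_union_le _ _) (card_union_le _ _)))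
  -- and the four families of leaving darts are disjoint parts of `leaving U`
  set L₁ := (leaving U).filter fun p => Q₁ p.1 ∧ (p.2 = 0 ∨ p.2 = 1) with hL₁
  set L₂ := (leaving U).filter fun p => Q₂ p.1 ∧ (p.2 = 2 ∨ p.2 = 3) with hL₂
  set L₃ := (leaving U).filter fun p => Q₃ p.1 ∧ (p.2 = 0 ∨ p.2 = 1) with hL₃
  set L₄ := (leaving U).filter fun p => Q₄ p.1 ∧ (p.2 = 2 ∨ p.2 = 3) with hL₄
  have d12 : Disjoint L₁ L₂ := disjoint_left.2 fun p h h' => by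
    rw [hL₁, mem_filter] at h; rw [hL₂, mem_filter] at h'; simp only [Q₁, Q₂] at h h'; omega
  have d34 : Disjoint L₃ L₄ := disjoint_left.2 fun p h h' => by
    rw [hL₃, mem_filter] at h; rw [hL₄, mem_filter] at h'; simp only [Q₃, Q₄] at h h'; omega
  have d1234 : Disjoint (L₁ ∪ L₂) (L₃ ∪ L₄) := disjoint_left.2 fun p h h' => by
    rw [mem_union, hL₁, hL₂, mem_filter, mem_filter] at h
    rw [mem_union, hL₃, hL₄, mem_filter, mem_filter] at h'
    simp only [Q₁, Q₂, Q₃, Q₄] at h h'; omega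
  have hL : L₁.card + L₂.card + (L₃.card + L₄.card) ≤ (leaving U).card := by
    rw [← card_union_of_disjoint d12, ← card_union_of_disjoint d34, ← card_union_of_disjoint d1234]
    exact card_le_card (union_subset (union_subset (filter_subset _ _) (filter_subset _ _))
      (union_subset (filter_subset _ _) (filter_subset _ _)))
  omega

/-! ### The `ℓ¹` co-area bound -/

/-- A window for a function: outside `V` the function and its two forward shifts vanish. [folklore] -/
def IsWindow (V : Finset (ℤ × ℤ)) (F : ℤ × ℤ → ℝ) : Prop := ∀ z ∉ V, F z = 0 ∧ F (shS z) = 0 ∧ F (shT z) = 0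

/-- The `ℓ¹` shear variation over the window. [folklore] -/
noncomputable def var₁ (V : Finset (ℤ × ℤ)) (F : ℤ × ℤ → ℝ) : ℝ := ∑ z ∈ V, (|F (shS z) - F z| + |F (shT z) - F z|)

/-- The variation of an indicator dominates its leaving darts. [cite: Lee2013GL2Z, Lemma 2.2 (edges leaving U)] -/
theorem card_leaving_le_var₁ (V U : Finset (ℤ × ℤ)) (hUV : U ⊆ V) (hV : ∀ z ∉ V, shS z ∉ U ∧ shT z ∉ U) :
    ((leaving U).card : ℝ) ≤ var₁ V (fun z => if z ∈ U then 1 else 0) := by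
  classical
  -- the index set of the variation and its `1`-terms
  let B₀ : Finset (ℤ × ℤ) := V.filter fun z => (z ∈ U) ≠ (shS z ∈ U)
  let B₁ : Finset (ℤ × ℤ) := V.filter fun z => (z ∈ U) ≠ (shT z ∈ U)
  have hvar : var₁ V (fun z => if z ∈ U then 1 else 0) = (B₀.card : ℝ) + B₁.card := by
    rw [var₁, sum_add_distrib, card_filter, card_filter]
    push_cast
    congr 1 <;> refine sum_congr rfl fun z _ => ?_ <;>
      by_cases h1 : z ∈ U <;> by_cases h2 : shS z ∈ U <;> by_cases h3 : shT z ∈ U <;> simp [h1, h2, h3]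
  -- the leaving darts by label
  have hsplit : (leaving U).card = ∑ i : Fin 4, ((leaving U).filter fun p => p.2 = i).card := by
    rw [← card_eq_sum_card_fiberwise (f := fun p : (ℤ × ℤ) × Fin 4 => p.2) (t := univ) fun _ _ => mem_univ _]
  have hlab : ∀ i : Fin 4, ((leaving U).filter fun p => p.2 = i).card = (U.filter fun z => sh i z ∉ U).card := fun i => by
    refine card_bij (fun p _ => p.1) (fun p hp => ?_) (fun p hp p' hp' h => ?_) (fun z hz => ?_)
    · rw [mem_filter, leaving, mem_filter, mem_product] at hp
      rw [mem_filter]; obtain ⟨⟨⟨h1, -⟩, h2⟩, rfl⟩ := hp; exact ⟨h1, h2⟩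
    · rw [mem_filter] at hp hp'
      exact Prod.ext h (hp.2.trans hp'.2.symm)
    · rw [mem_filter] at hz
      exact ⟨(z, i), by rw [mem_filter, leaving, mem_filter, mem_product]; exact ⟨⟨⟨hz.1, mem_univ _⟩, hz.2⟩, rfl⟩, rfl⟩
  rw [hsplit, Fin.sum_univ_four, hlab, hlab, hlab, hlab, hvar]
  have hsh0 : ∀ z, sh 0 z = shS z := fun z => rfl
  have hsh1 : ∀ z, sh 1 z = shT z := fun z => rfl
  have hsh2 : ∀ z, sh 2 z = shSi z := fun z => rfl
  have hsh3 : ∀ z, sh 3 z = shTi z := fun z => rfl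
  simp only [hsh0, hsh1, hsh2, hsh3]
  -- forward `S`-darts and backward `S⁻¹`-darts give disjoint parts of `B₀`; same for `T`
  have hB₀ : (U.filter fun z => shS z ∉ U).card + (U.filter fun z => shSi z ∉ U).card ≤ B₀.card := by
    rw [← card_image_of_injective (U.filter fun z => shSi z ∉ U) shSi_injective, ← card_union_of_disjoint]
    · refine card_le_card fun w hw => ?_
      rw [mem_union, mem_filter, mem_image] at hw
      rw [mem_filter]
      rcases hw with ⟨hwU, hS⟩ | ⟨z, hz, rfl⟩
      · exact ⟨hUV hwU, by simp [hwU, hS]⟩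
      · rw [mem_filter] at hz
        refine ⟨?_, by simp [hz.1, hz.2]⟩
        by_contra hVw
        exact (hV _ hVw).1 (by simpa using hz.1)
    · rw [disjoint_left]
      intro w hw hw'
      rw [mem_filter] at hw
      rw [mem_image] at hw'
      obtain ⟨z, hz, rfl⟩ := hw'
      exact (mem_filter.1 hz).2 hw.1
  have hB₁ : (U.filter fun z => shT z ∉ U).card + (U.filter fun z => shTi z ∉ U).card ≤ B₁.card := by
    rw [← card_image_of_injective (U.filter fun z => shTi z ∉ U) shTi_injective, ← card_union_of_disjoint]
    · refine card_le_card fun w hw => ?_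
      rw [mem_union, mem_filter, mem_image] at hw
      rw [mem_filter]
      rcases hw with ⟨hwU, hS⟩ | ⟨z, hz, rfl⟩
      · exact ⟨hUV hwU, by simp [hwU, hS]⟩
      · rw [mem_filter] at hz
        refine ⟨?_, by simp [hz.1, hz.2]⟩
        by_contra hVw
        exact (hV _ hVw).2 (by simpa using hz.1)
    · rw [disjoint_left]
      intro w hw hw'
      rw [mem_filter] at hw
      rw [mem_image] at hw'
      obtain ⟨z, hz, rfl⟩ := hw'
      exact (mem_filter.1 hz).2 hw.1
  have h0 := hB₀
  have h1 := hB₁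
  push_cast
  have : ((U.filter fun z => shS z ∉ U).card : ℝ) + (U.filter fun z => shSi z ∉ U).card ≤ B₀.card := by exact_mod_cast hB₀
  have : ((U.filter fun z => shT z ∉ U).card : ℝ) + (U.filter fun z => shTi z ∉ U).card ≤ B₁.card := by exact_mod_cast hB₁
  linarith

/-- **The `ℓ¹` co-area bound**: for `F ≥ 0` vanishing at `0` and windowed by `V`,
`∑_{z ∈ V} F z ≤ var₁ V F`. [cite: Lee2013GL2Z, Lemma 2.1 (co-area) with Lemma 2.2] -/
theorem sum_le_var₁ (V : Finset (ℤ × ℤ)) :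
    ∀ (F : ℤ × ℤ → ℝ), (∀ z, 0 ≤ F z) → F (0, 0) = 0 → IsWindow V F → ∑ z ∈ V, F z ≤ var₁ V F := by
  classical
  -- induction on the number of points of `V` where `F` is positive
  suffices key : ∀ (n : ℕ) (F : ℤ × ℤ → ℝ), (V.filter fun z => 0 < F z).card ≤ n → (∀ z, 0 ≤ F z) → F (0, 0) = 0 →
      IsWindow V F → ∑ z ∈ V, F z ≤ var₁ V F from fun F h0 hF0 hW => key _ F le_rfl h0 hF0 hW
  intro n
  induction n with
  | zero =>
    intro F hcard h0 _ _
    have hzero : ∀ z ∈ V, F z = 0 := fun z hz => by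
      have : z ∉ V.filter fun z => 0 < F z := by rw [Nat.le_zero, card_eq_zero] at hcard; rw [hcard]; simp
      rw [mem_filter, not_and] at this
      exact le_antisymm (not_lt.1 (this hz)) (h0 z)
    rw [sum_eq_zero hzero]
    exact sum_nonneg fun z _ => add_nonneg (abs_nonneg _) (abs_nonneg _)
  | succ n ih =>
    intro F hcard h0 hF0 hW
    set U := V.filter fun z => 0 < F z with hU
    rcases U.eq_empty_or_nonempty with hUe | hUne
    · exact ih F (by rw [← hU, hUe, card_empty]; exact Nat.zero_le _) h0 hF0 hW
    -- the minimum positive value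
    obtain ⟨z₀, hz₀, hmin⟩ := exists_min_image U F hUne
    set m := F z₀ with hm
    have hm0 : 0 < m := (mem_filter.1 hz₀).2
    have hmle : ∀ z, 0 < F z → m ≤ F z := fun z hz => by
      by_cases hzV : z ∈ V
      · exact hmin z (mem_filter.2 ⟨hzV, hz⟩)
      · exact absurd (hW z hzV).1 hz.ne'
    -- peel: `F = m 1_U + F'`
    set F' : ℤ × ℤ → ℝ := fun z => if 0 < F z then F z - m else 0 with hF'
    have hF'0 : ∀ z, 0 ≤ F' z := fun z => by
      simp only [hF']; split_ifs with h
      · linarith [hmle z h]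
      · exact le_rfl
    have hdecomp : ∀ z, F z = m * (if 0 < F z then 1 else 0) + F' z := fun z => by
      simp only [hF']; split_ifs with h
      · ring
      · have := le_antisymm (not_lt.1 h) (h0 z); rw [this]; ring
    have hF'00 : F' (0, 0) = 0 := by simp [hF', hF0]
    have hW' : IsWindow V F' := fun z hz => by
      obtain ⟨h1, h2, h3⟩ := hW z hz
      simp [hF', h1, h2, h3]
    -- the positive set of `F'` lost `z₀`
    have hcard' : (V.filter fun z => 0 < F' z).card ≤ n := by
      have hsub : (V.filter fun z => 0 < F' z) ⊆ U.erase z₀ := by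
        intro z hz
        rw [mem_filter] at hz
        rw [mem_erase, hU, mem_filter]
        have hpos : 0 < F z := by
          by_contra h; simp [hF', h] at hz
        refine ⟨fun h => ?_, hz.1, hpos⟩
        subst h
        simp [hF', hm0, ← hm] at hz
      have := card_le_card hsub
      rw [card_erase_of_mem hz₀] at this
      omega
    have ih' := ih F' hcard' hF'0 hF'00 hW'
    -- the indicator part
    have hind : (m * (U.card : ℝ)) ≤ m * var₁ V (fun z => if z ∈ U then 1 else 0) := by
      refine mul_le_mul_of_nonneg_left ?_ hm0.le
      have h00 : ((0, 0) : ℤ × ℤ) ∉ U := by rw [hU, mem_filter, hF0]; simp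
      have hl := card_le_card_leaving U h00
      have hlR : (U.card : ℝ) ≤ (leaving U).card := by exact_mod_cast hl
      refine hlR.trans (card_leaving_le_var₁ V U (filter_subset _ _) fun z hz => ?_)
      obtain ⟨-, h2, h3⟩ := hW z hz
      rw [hU, mem_filter, mem_filter, h2, h3]
      exact ⟨fun h => lt_irrefl _ h.2, fun h => lt_irrefl _ h.2⟩
    -- same-sign additivity of the variation
    have hsplit : var₁ V F = m * var₁ V (fun z => if z ∈ U then 1 else 0) + var₁ V F' := by
      rw [var₁, var₁, var₁, mul_sum, ← sum_add_distrib]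
      refine sum_congr rfl fun z hz => ?_
      have hUmem : ∀ w, (w ∈ U ↔ 0 < F w) ∨ (w ∉ V) := fun w => by
        by_cases hw : w ∈ V
        · left; rw [hU, mem_filter]; exact ⟨fun h => h.2, fun h => ⟨hw, h⟩⟩
        · right; exact hw
      have key : ∀ a b : ℤ × ℤ, (a ∈ U ↔ 0 < F a) → (b ∈ U ↔ 0 < F b) →
          |F a - F b| = m * |(if a ∈ U then (1 : ℝ) else 0) - (if b ∈ U then 1 else 0)| + |F' a - F' b| := by
        intro a b ha hb
        simp only [hF']
        by_cases hpa : 0 < F a <;> by_cases hpb : 0 < F b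
        · have ha' : a ∈ U := ha.2 hpa; have hb' : b ∈ U := hb.2 hpb
          rw [if_pos hpa, if_pos hpb, if_pos ha', if_pos hb', sub_self, abs_zero, mul_zero, zero_add]
          congr 1; ring
        · have ha' : a ∈ U := ha.2 hpa; have hb' : b ∉ U := fun h => hpb (hb.1 h)
          have hFb : F b = 0 := le_antisymm (not_lt.1 hpb) (h0 b)
          have hge := hmle a hpa
          rw [if_pos hpa, if_neg hpb, if_pos ha', if_neg hb', hFb, sub_zero, sub_zero, sub_zero, abs_one, mul_one,
            abs_of_pos hpa, abs_of_nonneg (sub_nonneg.2 hge)]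
          ring
        · have ha' : a ∉ U := fun h => hpa (ha.1 h); have hb' : b ∈ U := hb.2 hpb
          have hFa : F a = 0 := le_antisymm (not_lt.1 hpa) (h0 a)
          have hge := hmle b hpb
          rw [if_neg hpa, if_pos hpb, if_neg ha', if_pos hb', hFa, zero_sub, zero_sub, zero_sub, abs_neg, abs_neg, abs_neg,
            abs_one, mul_one, abs_of_pos hpb, abs_of_nonneg (sub_nonneg.2 hge)]
          ring
        · have ha' : a ∉ U := fun h => hpa (ha.1 h); have hb' : b ∉ U := fun h => hpb (hb.1 h)
          have hFa : F a = 0 := le_antisymm (not_lt.1 hpa) (h0 a)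
          have hFb : F b = 0 := le_antisymm (not_lt.1 hpb) (h0 b)
          rw [if_neg hpa, if_neg hpb, if_neg ha', if_neg hb', hFa, hFb]
          simp
      -- membership facts for `shS z`, `shT z`, `z`
      have hz' : z ∈ U ↔ 0 < F z := by rw [hU, mem_filter]; exact ⟨fun h => h.2, fun h => ⟨hz, h⟩⟩
      have hS : shS z ∈ U ↔ 0 < F (shS z) := by
        rcases hUmem (shS z) with h | h
        · exact h
        · rw [hU, mem_filter, (hW _ h).1]; simp [h]
      have hT : shT z ∈ U ↔ 0 < F (shT z) := by
        rcases hUmem (shT z) with h | h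
        · exact h
        · rw [hU, mem_filter, (hW _ h).1]; simp [h]
      rw [key _ _ hS hz', key _ _ hT hz']
      ring
    -- assemble
    calc ∑ z ∈ V, F z = ∑ z ∈ V, (m * (if 0 < F z then 1 else 0) + F' z) := sum_congr rfl fun z _ => hdecomp z
      _ = m * U.card + ∑ z ∈ V, F' z := by
          rw [sum_add_distrib, ← mul_sum, hU, card_filter]; push_cast; ring
      _ ≤ m * var₁ V (fun z => if z ∈ U then 1 else 0) + var₁ V F' := add_le_add hind ih'
      _ = var₁ V F := hsplit.symm

/-! ### The `ℓ²` bound -/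

/-- The shear energy over the window. [cite: Lee2013GL2Z, §2 (Rayleigh quotient numerator)] -/
noncomputable def energy (V : Finset (ℤ × ℤ)) (h : ℤ × ℤ → ℝ) : ℝ := ∑ z ∈ V, ((h (shS z) - h z) ^ 2 + (h (shT z) - h z) ^ 2)

/-- Shifted sums do not exceed the full sum (window and injectivity). [folklore] -/
theorem sum_sq_shift_le (V : Finset (ℤ × ℤ)) (h : ℤ × ℤ → ℝ) (hW : IsWindow V h) :
    ∑ z ∈ V, h (shS z) ^ 2 ≤ ∑ z ∈ V, h z ^ 2 ∧ ∑ z ∈ V, h (shT z) ^ 2 ≤ ∑ z ∈ V, h z ^ 2 := by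
  classical
  constructor
  · calc ∑ z ∈ V, h (shS z) ^ 2 = ∑ z ∈ V.filter (fun z => shS z ∈ V), h (shS z) ^ 2 := by
          rw [sum_filter]; refine sum_congr rfl fun z hz => ?_
          split_ifs with h'
          · rfl
          · rw [(hW _ h').1]; ring
      _ = ∑ w ∈ (V.filter fun z => shS z ∈ V).image shS, h w ^ 2 := by
          rw [sum_image fun a _ b _ hab => shS_injective hab]
      _ ≤ ∑ w ∈ V, h w ^ 2 := sum_le_sum_of_subset_of_nonneg (fun w hw => by
          rw [mem_image] at hw; obtain ⟨z, hz, rfl⟩ := hw; exact (mem_filter.1 hz).2) fun _ _ _ => sq_nonneg _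
  · calc ∑ z ∈ V, h (shT z) ^ 2 = ∑ z ∈ V.filter (fun z => shT z ∈ V), h (shT z) ^ 2 := by
          rw [sum_filter]; refine sum_congr rfl fun z hz => ?_
          split_ifs with h'
          · rfl
          · rw [(hW _ h').1]; ring
      _ = ∑ w ∈ (V.filter fun z => shT z ∈ V).image shT, h w ^ 2 := by
          rw [sum_image fun a _ b _ hab => shT_injective hab]
      _ ≤ ∑ w ∈ V, h w ^ 2 := sum_le_sum_of_subset_of_nonneg (fun w hw => by
          rw [mem_image] at hw; obtain ⟨z, hz, rfl⟩ := hw; exact (mem_filter.1 hz).2) fun _ _ _ => sq_nonneg _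

/-- **The discrete Cheeger step** (Lee, Lemma 2.1 with Lemma 2.2, `Δ = 4`): for `h ≥ 0` vanishing at `0`
and windowed by `V`, `∑_{z ∈ V} h(z)² ≤ 8 · energy V h`. [cite: Lee2013GL2Z, Lemma 2.1 and Lemma 2.2] -/
theorem sum_sq_le_eight_mul_energy (V : Finset (ℤ × ℤ)) (h : ℤ × ℤ → ℝ) (h0 : ∀ z, 0 ≤ h z) (h00 : h (0, 0) = 0)
    (hW : IsWindow V h) : ∑ z ∈ V, h z ^ 2 ≤ 8 * energy V h := by
  -- `F = h²`
  have hWF : IsWindow V (fun z => h z ^ 2) := fun z hz => by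
    obtain ⟨a, b, c⟩ := hW z hz; simp [a, b, c]
  have hco := sum_le_var₁ V (fun z => h z ^ 2) (fun z => sq_nonneg _) (by simp [h00]) hWF
  -- `|h(Mz)² - h(z)²| = |h(Mz) - h(z)| (h(Mz) + h(z))`, then Cauchy–Schwarz
  set A : ℝ := ∑ z ∈ V, h z ^ 2 with hA
  have hvar : var₁ V (fun z => h z ^ 2) = ∑ z ∈ V, (|h (shS z) - h z| * (h (shS z) + h z) + |h (shT z) - h z| * (h (shT z) + h z)) := by
    rw [var₁]
    refine sum_congr rfl fun z _ => ?_
    have e : ∀ a b : ℝ, 0 ≤ a → 0 ≤ b → |a ^ 2 - b ^ 2| = |a - b| * (a + b) := fun a b ha hb => by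
      rw [sq_sub_sq, abs_mul, abs_of_nonneg (add_nonneg ha hb), mul_comm]
    simp only [e _ _ (h0 _) (h0 _)]
  -- Cauchy–Schwarz: `(∑ |d| s)² ≤ (∑ d²) (∑ s²)` on the index set `V × {S, T}`
  have hCS : (var₁ V (fun z => h z ^ 2)) ^ 2 ≤ energy V h * ∑ z ∈ V, ((h (shS z) + h z) ^ 2 + (h (shT z) + h z) ^ 2) := by
    rw [hvar]
    have := sum_mul_sq_le_sq_mul_sq (V ×ˢ (univ : Finset (Fin 2)))
      (fun q => if q.2 = 0 then |h (shS q.1) - h q.1| else |h (shT q.1) - h q.1|)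
      (fun q => if q.2 = 0 then h (shS q.1) + h q.1 else h (shT q.1) + h q.1)
    have e1 : ∑ q ∈ V ×ˢ (univ : Finset (Fin 2)), (if q.2 = 0 then |h (shS q.1) - h q.1| else |h (shT q.1) - h q.1|) *
        (if q.2 = 0 then h (shS q.1) + h q.1 else h (shT q.1) + h q.1) =
        ∑ z ∈ V, (|h (shS z) - h z| * (h (shS z) + h z) + |h (shT z) - h z| * (h (shT z) + h z)) := by
      rw [sum_product]; refine sum_congr rfl fun z _ => ?_; rw [Fin.sum_univ_two]; simp
    have e2 : ∑ q ∈ V ×ˢ (univ : Finset (Fin 2)), (if q.2 = 0 then |h (shS q.1) - h q.1| else |h (shT q.1) - h q.1|) ^ 2 =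
        energy V h := by
      rw [energy, sum_product]; refine sum_congr rfl fun z _ => ?_; rw [Fin.sum_univ_two]; simp [sq_abs]
    have e3 : ∑ q ∈ V ×ˢ (univ : Finset (Fin 2)), (if q.2 = 0 then h (shS q.1) + h q.1 else h (shT q.1) + h q.1) ^ 2 =
        ∑ z ∈ V, ((h (shS z) + h z) ^ 2 + (h (shT z) + h z) ^ 2) := by
      rw [sum_product]; refine sum_congr rfl fun z _ => ?_; rw [Fin.sum_univ_two]; simp
    rw [e1, e2, e3] at this
    exact this
  -- `∑ (h(Mz) + h(z))² ≤ 2 ∑ (h(Mz)² + h(z)²) ≤ 8 A`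
  have hsum2 : ∑ z ∈ V, ((h (shS z) + h z) ^ 2 + (h (shT z) + h z) ^ 2) ≤ 8 * A := by
    obtain ⟨hS, hT⟩ := sum_sq_shift_le V h hW
    have : ∀ z, (h (shS z) + h z) ^ 2 + (h (shT z) + h z) ^ 2 ≤ 2 * (h (shS z) ^ 2 + h z ^ 2) + 2 * (h (shT z) ^ 2 + h z ^ 2) :=
      fun z => by nlinarith [sq_nonneg (h (shS z) - h z), sq_nonneg (h (shT z) - h z)]
    calc _ ≤ ∑ z ∈ V, (2 * (h (shS z) ^ 2 + h z ^ 2) + 2 * (h (shT z) ^ 2 + h z ^ 2)) := sum_le_sum fun z _ => this z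
      _ = 2 * (∑ z ∈ V, h (shS z) ^ 2 + A) + 2 * (∑ z ∈ V, h (shT z) ^ 2 + A) := by
          rw [hA, ← sum_add_distrib, ← sum_add_distrib, mul_sum, mul_sum, ← sum_add_distrib]
      _ ≤ 8 * A := by linarith
  -- `A ≤ var ≤ √(energy · 8A)`, so `A² ≤ 8 A · energy`
  have hA0 : 0 ≤ A := sum_nonneg fun z _ => sq_nonneg _
  have hE0 : 0 ≤ energy V h := sum_nonneg fun z _ => add_nonneg (sq_nonneg _) (sq_nonneg _)
  have h2 : A ^ 2 ≤ energy V h * (8 * A) :=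
    calc A ^ 2 ≤ (var₁ V (fun z => h z ^ 2)) ^ 2 := pow_le_pow_left₀ hA0 hco 2
      _ ≤ energy V h * ∑ z ∈ V, ((h (shS z) + h z) ^ 2 + (h (shT z) + h z) ^ 2) := hCS
      _ ≤ energy V h * (8 * A) := mul_le_mul_of_nonneg_left hsum2 hE0
  by_cases hA' : A = 0
  · calc A = 0 := hA'
      _ ≤ 8 * energy V h := by linarith [hE0]
  · have hApos : 0 < A := lt_of_le_of_ne hA0 (Ne.symm hA')
    nlinarith

end GabberGalil

end Literature.Computability.Complexity
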